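import Summits.BirchSwinnertonDyer.Rank1Residual.Partition.Rows
import Literature.Barriers.BirchSwinnertonDyer.EulerSystemBigImageAtSmallImage
import HarnessLib

/-!
# Route `ErratumRoadFive` (rung K2), crux `NonSurjCorner` (item stmt-BirchSwinnertonDyer-19065): THE BIG-IMAGE BARRIER PLACED ON THE
# (T4′) CORNER AND ITS LEAF TWINS — every printed INTEGRAL Euler-system ∕ (im)-keyed main-conjecture theorem is void there
# (cell `bsd-stepL`, seat `bsd-stepL-corner-p1` g20; `--supports stmt-BirchSwinnertonDyer-19065 --as helper`)

WHY THIS FILE. The barrier catalogue entry `Literature/Barriers/BirchSwinnertonDyer/EulerSystemBigImageAtSmallImage` proves, for every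
prime `p`, `Irr W p → ¬ Surj W p → ¬ KatoBigImageHypothesis W p` (the class (12.5.2) ∨ `p`-adic surjectivity ∨ (im) = (Im) = `BigIm`; a
rank-one cokernel `T/(σ−1)T` gives a transvection mod `p`, an irreducible image with a transvection is onto) and PLACES it on the residual classes
X9, X10b, X7, X8, X4 — which live Literature-side. The corner's classes `ClassX11b` (rank 1) and `ClassX11a` (its rank-0 leaf twins) are
Summits-side (`Rank1Residual/Partition/Rows`), so the barrier file cannot name them; this file does. Consequence for the corner's lines: no binder of a
`BurungaleCastellaSkinner2025.*` ∕ `YanZhu2026.*_of_bigIm` ∕ Kato (12.5.2) ∕ Sprung-type fact can ever be discharged at a corner pair or at one of its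
non-surjective leaf twins — the INTEGRAL cyclotomic road to the twin's lower half (`Typed.MissingLowerBoundAt Wd p`) and to the converse half is closed in
print by hypothesis, not by accident (this is why line `hybrid` routes the twin through crux 19064 ∕ analytic μ = 0 and the converse half through
Kolyvagin certificates). First-hand group check (memo CORNER-G20 §2): in `G₉ ≤ GL₂(𝔽₅)` (order 96; `G₉ ∩ SL₂` of order 24) and in `N(C_s) ∩ SL₂` at
`5` and `7`, no non-identity element has eigenvalue `1`.
* `NonSurjCorner.not_katoBigImageHypothesis`, `NonSurjCorner.not_bigIm` (X11b ∧ ¬Surj); `NonSurjTwin.not_katoBigImageHypothesis`, `NonSurjTwin.not_bigIm`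
  (X11a ∧ ¬Surj); `NonSurjCorner.not_bigIm_of_binders` (the crux's displayed binder list, `p ∈ {5,7}` idle).

HONEST FRAMING: placement corollaries of an ESTABLISHED barrier theorem (two-line proofs); nothing about `Ш`, no named fact, no `sorry`; 19065 NOT
closed; no census word, tier or label moves (T7); BSD is proved for no curve.
References: [cite: Kato2004Asterisque, (12.5.2) in Thm. 12.5 (4) (p. 222), Thm. 13.4 (3) (p. 226)] [cite: BurungaleCastellaSkinner2025, p. 2 (im), Rem. 1.1.3 (iii)]
[cite: Serre1972, §2.4 Prop. 15] [cite: YanZhu2024MainConjNonCM, Thm. 1.2 (Im), Thm. 4.15].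
-/

set_option autoImplicit false
set_option linter.dupNamespace false -- `Summit.BirchSwinnertonDyer.BirchSwinnertonDyer` (summit = problem), tree-wide

noncomputable section

open scoped Classical

namespace Summit.BirchSwinnertonDyer.BirchSwinnertonDyer.Theorems

open WeierstrassCurve
  Literature.NumberTheory.EllipticCurves
  Literature.NumberTheory.EllipticCurves.Rank1Residual
  Literature.Barriers.BirchSwinnertonDyer
  Summit.BirchSwinnertonDyer.Rank1Residual

variable {W : WeierstrassCurve ℚ} [W.IsElliptic] {p : ℕ} [Fact p.Prime]

/-- **The big-image barrier on the (T4′) corner**: at a corner pair (`ClassX11b W p`, `ρ̄_{E,p}` not onto) Kato's (12.5.2), `p`-adic surjectivity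
and (im) = (Im) = `BigIm` all fail — `KatoBigImageHypothesis W p` is false. (Any `p`; the crux's `p ∈ {5,7}` is idle here.)
[cite: Kato2004Asterisque, (12.5.2) in Thm. 12.5 (4) (p. 222)] [cite: BurungaleCastellaSkinner2025, Rem. 1.1.3 (iii) (p. 2)] [cite: Serre1972, §2.4 Prop. 15] -/
theorem NonSurjCorner.not_katoBigImageHypothesis (hX : ClassX11b W p) (hns : ¬ Surj W p) :
    ¬ KatoBigImageHypothesis W p :=
  not_katoBigImageHypothesis_of_irr_of_not_surj W p hX.2.2.2 hns

/-- **(im) ∕ (Im) fails at every corner pair**: no `τ ∈ Γ_{ℚ(μ_{p^∞})}` has `T_pE/(ρ(τ)−1)T_pE` free of `ℤ_p`-rank one — so the INTEGRAL clauses of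
Burungale–Castella–Skinner 2025 Thm. 1.1.2 (b) ∕ Cor. 1.3.1 and of Yan–Zhu 2026 Thm. 1.2 ∕ 4.15 (tree binders `him : BigIm W p`) are not instantiable there.
[cite: BurungaleCastellaSkinner2025, p. 2, hypothesis (im)] [cite: YanZhu2024MainConjNonCM, Thm. 1.2, hypothesis (Im)] -/
theorem NonSurjCorner.not_bigIm (hX : ClassX11b W p) (hns : ¬ Surj W p) : ¬ BigIm W p :=
  fun h => NonSurjCorner.not_katoBigImageHypothesis hX hns (katoBigImageHypothesis_of_bigIm W p h)

/-- **The barrier on the corner's LEAF TWINS** (the rank-0 class `ClassX11a`: multiplicative `p`, `E[p]` irreducible, no (ram) witness — the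
Friedberg–Hoffstein twins `Wd = Cd • E^{(d_K)}` of a corner pair are such, with `ρ̄_{Wd,p} = ρ̄_{E,p} ⊗ χ_{d_K}` not onto): `KatoBigImageHypothesis Wd p`
is false. [cite: Kato2004Asterisque, (12.5.2) in Thm. 12.5 (4) (p. 222)] [cite: Serre1972, §2.4 Prop. 15] -/
theorem NonSurjTwin.not_katoBigImageHypothesis [W.IsGloballyMinimal] (hXa : ClassX11a W p) (hns : ¬ Surj W p) :
    ¬ KatoBigImageHypothesis W p :=
  not_katoBigImageHypothesis_of_irr_of_not_surj W p hXa.2.2.2.1 hns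

/-- **(im) ∕ (Im) fails at every non-surjective leaf twin** — the integral cyclotomic road to the twin's lower half `Typed.MissingLowerBoundAt Wd p`
through an (im)-keyed main conjecture is closed by hypothesis. [cite: BurungaleCastellaSkinner2025, p. 2, hypothesis (im)]
[cite: YanZhu2024MainConjNonCM, Thm. 4.15, hypothesis (Im)] -/
theorem NonSurjTwin.not_bigIm [W.IsGloballyMinimal] (hXa : ClassX11a W p) (hns : ¬ Surj W p) : ¬ BigIm W p :=
  fun h => NonSurjTwin.not_katoBigImageHypothesis hXa hns (katoBigImageHypothesis_of_bigIm W p h)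

/-- **Displayed-binder form** (the crux's hypothesis list verbatim; binders 3–5 idle): at every (T4′) corner pair the big-image hypothesis class is
false. [cite: Kato2004Asterisque, (12.5.2) in Thm. 12.5 (4) (p. 222)] [cite: BurungaleCastellaSkinner2025, Rem. 1.1.3 (iii) (p. 2)] -/
theorem NonSurjCorner.not_katoBigImageHypothesis_of_binders :
    ∀ (W : WeierstrassCurve ℚ) [W.IsElliptic] [W.IsGloballyMinimal] (p : ℕ) [Fact p.Prime],
      ClassX11b W p → ¬ Surj W p → (p = 5 ∨ p = 7) → p ∣ padicValInt p W.minimalDiscriminantInt → ¬ Ram W p →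
      ¬ KatoBigImageHypothesis W p ∧ ¬ BigIm W p :=
  fun _ _ _ _ _ hX hns _ _ _ => ⟨NonSurjCorner.not_katoBigImageHypothesis hX hns, NonSurjCorner.not_bigIm hX hns⟩

end Summit.BirchSwinnertonDyer.BirchSwinnertonDyer.Theorems

end
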